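import Summits.Langlands.Langlands.Theses.RamifiedCoefficientSeed
import Summits.Langlands.Langlands.Theses.WachComponentCensus
import Literature.NumberTheory.Automorphic.LocalLanglandsDatum
import Literature.NumberTheory.GaloisRepresentations.LocalClassFieldTheory
import HarnessLib

/-!
# Birth skeleton (BC3) for the split child `CanonicalReciprocityData` of `RamifiedCoefficientSeed.SectorComplement`
(crux-strategist cstrat-stmt-Langlands-16781-r1, 2026-08-17; child item: stmt-Langlands-17930 (verbatim; attached child of 16781))

RD = the summit's non-vacuity conjunct `∀ F, Nonempty (ReciprocityData F)`: a local Langlands datum at every completion whose Artin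
map AND whose ε-system's Artin maps (at every finite `E/F_v`) are THE canonical ones.  In print textbook input; in tree NOT
derivable from the cite-only named facts `LocalLanglandsDatum.nonempty` / `nonempty_localEpsilonSystem` (neither records the
normalisation).  Split LOCAL CONSTANTS / LOCAL LANGLANDS: (1) Deligne's system of local constants normalised against the
canonical Artin maps of all finite extensions exists (Deligne 1973 Thm. 4.1 + local class field theory); (2) Harris–Taylor's
`rec` exists RELATIVE TO any such canonically normalised system (Harris–Taylor Thm. A / Henniart + Deligne's uniqueness
`localEpsilonSystem_unique`).  Both are theorems of the literature (T0 debts, sizes L / XL).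

BY-NAME VERSION: the child item is SHARED — it is stmt-level identical to `Summit.Langlands.Langlands.Theses.WachComponentCensus.CanonicalReciprocityData`
(an existing decl), so this skeleton concludes THAT decl by name (`open … WachComponentCensus (CanonicalReciprocityData)`); after `route edit --split` the
homonymous `RamifiedCoefficientSeed.CanonicalReciprocityData` is definitionally the same term.  Register with
`ledger skeleton check <this file> --crux <child item> --crux-decl Summit.Langlands.Langlands.Theses.WachComponentCensus.CanonicalReciprocityData`.
`lean check`: rc 0, sorries = the `stub_*` only; `CanonicalReciprocityData_of` concludes the child BY NAME.
-/

noncomputable section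

set_option linter.dupNamespace false

namespace Summit.Langlands.Langlands.Cruxes.SectorComplement.BirthCanonicalReciprocityData

open scoped NumberField Classical Topology
open Filter IsDedekindDomain
open Literature.NumberTheory.Automorphic Literature.NumberTheory.GaloisRepresentations
open Summit.Langlands

open Summit.Langlands.Langlands.Theses.WachComponentCensus (CanonicalReciprocityData)

/-- **stub CANONICAL LOCAL CONSTANTS** — over every non-archimedean local field `F` there is a system of local constants
whose Artin map at EVERY finite extension `E/F` is the canonical one `canonicalArtin E` (Deligne 1973, Thm. 4.1 existence,
built from the Artin maps of local class field theory; the docstring of the named fact `nonempty_localEpsilonSystem` says its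
witness IS this system, but the fact as typed forgets the normalisation).  Size L (T0 debt).
[cite: Deligne1973, Thm. 4.1] [cite: SerreLocalFields1979, Ch. XIII §4 Thm. 1–2] -/
theorem stub_canonicalLocalConstants : ∀ (F : Type) [Field F] [ValuativeRel F] [TopologicalSpace F] [IsNonarchimedeanLocalField F], ∃ 𝓔 : Literature.NumberTheory.Automorphic.LocalEpsilonSystem F, ∀ (E : Type) [Field E] [ValuativeRel E] [TopologicalSpace E] [IsNonarchimedeanLocalField E] [Algebra F E] [FiniteDimensional F E], (𝓔.artin E).IsCanonical := by
  sorry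

/-- **stub LOCAL LANGLANDS FOR A CANONICAL ε-SYSTEM** — for every canonically normalised system of local constants `𝓔` over
`F` there is a local Langlands datum `L` with `L.eps = 𝓔` (hence `L.artin = 𝓔.artin F` canonical, by `eps_artin`):
Harris–Taylor 2001 Thm. A / Henniart 2000, stated relative to `Art_F` of local class field theory and Deligne's constants;
transport between two canonically normalised systems by Deligne's uniqueness (`localEpsilonSystem_unique`: they agree on every
continuous non-trivial `ψ` and Haar `μ`, the only inputs `IsLocalLanglandsGL` reads).  Why it might fail: only through a
typing slack of `LocalEpsilonSystem` on junk inputs, which the clauses of `IsLocalLanglandsGL` never evaluate.  Size XL (T0 debt).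
[cite: HarrisTaylorAMS2001, Thm. A] [cite: HenniartInventiones2000, Thm. 1.2] [cite: Deligne1973, Thm. 4.1] -/
theorem stub_localLanglandsOfCanonicalEps : ∀ (F : Type) [Field F] [ValuativeRel F] [TopologicalSpace F] [IsNonarchimedeanLocalField F] (𝓔 : Literature.NumberTheory.Automorphic.LocalEpsilonSystem F), (∀ (E : Type) [Field E] [ValuativeRel E] [TopologicalSpace E] [IsNonarchimedeanLocalField E] [Algebra F E] [FiniteDimensional F E], (𝓔.artin E).IsCanonical) → ∃ L : Literature.NumberTheory.Automorphic.LocalLanglandsDatum F, L.eps = 𝓔 := by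
  sorry

namespace _Goal

/-- The statement of `stub_canonicalLocalConstants` (literally its type). [folklore] -/
def stub_canonicalLocalConstants : Prop :=
  type_of% @Summit.Langlands.Langlands.Cruxes.SectorComplement.BirthCanonicalReciprocityData.stub_canonicalLocalConstants

/-- The statement of `stub_localLanglandsOfCanonicalEps` (literally its type). [folklore] -/
def stub_localLanglandsOfCanonicalEps : Prop :=
  type_of% @Summit.Langlands.Langlands.Cruxes.SectorComplement.BirthCanonicalReciprocityData.stub_localLanglandsOfCanonicalEps

end _Goal

/-- **RD from its two stubs**: at each completion pick Deligne's canonical system, then Harris–Taylor's datum for it; the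
pins `llc_isCanonical` / `llc_eps_isCanonical` are read off `eps_artin` and `L.eps = 𝓔`. -/
theorem CanonicalReciprocityData_of (h1 : _Goal.stub_canonicalLocalConstants) (h2 : _Goal.stub_localLanglandsOfCanonicalEps) :
    CanonicalReciprocityData := by
  dsimp only [_Goal.stub_canonicalLocalConstants, _Goal.stub_localLanglandsOfCanonicalEps] at h1 h2
  intro K _ _
  have key : ∀ v : HeightOneSpectrum (𝓞 K), ∃ L : LocalLanglandsDatum (v.adicCompletion K),
      L.artin.IsCanonical ∧ ∀ (E : Type) [Field E] [ValuativeRel E] [TopologicalSpace E] [IsNonarchimedeanLocalField E]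
        [Algebra (v.adicCompletion K) E] [FiniteDimensional (v.adicCompletion K) E], (L.eps.artin E).IsCanonical := by
    intro v
    obtain ⟨𝓔, h𝓔⟩ := h1 (v.adicCompletion K)
    obtain ⟨L, hL⟩ := h2 (v.adicCompletion K) 𝓔 h𝓔
    refine ⟨L, ?_, ?_⟩
    · rw [LocalArtinData.IsCanonical, ← L.eps_artin, hL]
      exact h𝓔 (v.adicCompletion K)
    · intro E _ _ _ _ _ _
      rw [hL]
      exact h𝓔 E
  choose L hL1 hL2 using key
  exact ⟨⟨L, hL1, fun v E _ _ _ _ _ _ => hL2 v E⟩⟩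

/-- by-name sanity check -/
example : CanonicalReciprocityData := CanonicalReciprocityData_of stub_canonicalLocalConstants stub_localLanglandsOfCanonicalEps

end Summit.Langlands.Langlands.Cruxes.SectorComplement.BirthCanonicalReciprocityData

end
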